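import Summits.NavierStokesRegularity.NavierStokesRegularity.Theorems.CertifiedBlowupCertifiedBlowupAxisymBlowupKatoLifespan
import Summits.NavierStokesRegularity.NavierStokesRegularity.Theorems.CertifiedBlowupCertifiedBlowupAxisymBlowupL3Blowup
import Literature.Analysis.FluidPDE.KatoGlobalSmallHolds
import HarnessLib

/-!
# Kato's critical floor: the datum of every witness of the crux `CertifiedBlowupAxisymBlowup`
# is large in `L³(ℝ³)`

Theorems file landed `--supports stmt-NavierStokesRegularity-0727`, line `compact-amplification`
(continuation lead c4, wave S4; registered stub `eLpNorm_three_datum_gt_of_isMaximalSmoothSolution`).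
A witness of the crux is a viscosity `ν > 0`, a time `T > 0` and a maximal smooth solution `(u, p)`
of the unforced Navier–Stokes system of lifespan `T`, Leray–Hopf on `[0, T]` from its rapidly
decaying axisymmetric datum `u 0`. Kato 1984 (Math. Z. 187, Thms. 2 and 4): there is ONE absolute
`δ > 0` such that every weakly divergence-free `u₀ ∈ L³(ℝ³)` with `‖u₀‖_{L³} ≤ δ ν` launches a
GLOBAL mild solution in `C([0,∞); L³)` — the tree's discharged named fact `kato_global_small_holds`.
At the crux: the lifespan of a witness IS the Kato maximal time of its datum
(`katoMaximalTime_eq_of_isMaximalSmoothSolution`, hence finite), while a global Kato solution forces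
`T_max = ∞` (`HasGlobalKatoSolution.katoMaximalTime_eq_top`); so `‖u 0‖_{L³} > δ ν`. This is the
first data-level test a certified axisymmetric blow-up candidate `(ν, T, u₀)` must pass (route
CertifiedBlowup): smallness in the critical space `L³` is excluded, with one absolute constant.

No new definitions, no named-fact hypotheses, no `sorry`.

## References

* T. Kato, *Strong `L^p`-solutions of the Navier–Stokes equation in `ℝ^m`, with applications to
  weak solutions*, Math. Z. 187 (1984), 471–480, Thms. 2 and 4. [Kato1984MathZ]
* W. Rusin, V. Šverák, *Minimal initial data for potential Navier–Stokes singularities*,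
  J. Funct. Anal. 260 (2011), §3 p. 5 (the maximal time `T_max`). [RusinSverak2011]
* P. G. Lemarié-Rieusset, *The Navier–Stokes Problem in the 21st Century*, CRC 2016, Thm. 7.5 and
  Thm. 15.1. [LemarieRieusset2016]
-/

-- the summit and its single problem share the name (D-0017 nested layout)
set_option linter.dupNamespace false

noncomputable section

open MeasureTheory Set Function Filter Topology Metric
open scoped ENNReal NNReal

namespace Summit.NavierStokesRegularity.NavierStokesRegularity.Theorems.CertifiedBlowupAxisymBlowup.CompactAmplification

open Literature.Analysis Literature.Analysis.FluidPDE

/-- **Kato's critical floor for every witness** (registered stub of stmt-NavierStokesRegularity-0727;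
Kato 1984, Thms. 2 and 4): there is an absolute `ε > 0` such that every maximal Leray–Hopf classical
solution `(u, p)` of viscosity `ν > 0` and finite lifespan `T > 0` from a rapidly decaying
axisymmetric datum has `‖u 0‖_{L³(ℝ³)} > ε ν` (in `[0, ∞]`: `ofReal (ε ν) < ‖u 0‖_{L³}`). Take
`ε := δ`, Kato's small-data constant (`kato_global_small_holds`). The datum is an `L³` field
(`memLp_three_datum_of_lerayHopf_classical`) and weakly divergence free
(`IsLerayHopfOn.isWeaklyDivFree_datum`); were `‖u 0‖_{L³} ≤ δ ν`, Kato's theorem would give a global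
Kato solution from `u 0`, hence `katoMaximalTime ν (u 0) = ∞`
(`HasGlobalKatoSolution.katoMaximalTime_eq_top`), contradicting
`katoMaximalTime ν (u 0) = ofReal T` (`katoMaximalTime_eq_of_isMaximalSmoothSolution`).
[cite: Kato1984MathZ, Thm. 4] -/
theorem eLpNorm_three_datum_gt_of_isMaximalSmoothSolution : ∃ ε : ℝ, 0 < ε ∧ ∀ {ν T : ℝ} {u : ℝ → EuclideanSpace ℝ (Fin 3) → EuclideanSpace ℝ (Fin 3)} {p : ℝ → EuclideanSpace ℝ (Fin 3) → ℝ}, 0 < ν → 0 < T → IsMaximalSmoothSolution ν 0 u p T → IsLerayHopfOn T ν 0 (u 0) u → HasRapidSpatialDecay (u 0) → IsAxisymmetric (u 0) → ENNReal.ofReal (ε * ν) < eLpNorm (u 0) 3 volume := by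
  obtain ⟨δ, hδ, H⟩ := kato_global_small_holds
  refine ⟨δ, hδ, fun {ν T u p} hν hT hmax hLH hdec _haxi => ?_⟩
  -- contrapositive: a small datum has a global Kato solution, hence infinite Kato maximal time
  by_contra hle
  rw [not_lt] at hle
  have hu0 : MemLp (u 0) 3 volume := memLp_three_datum_of_lerayHopf_classical hν hT hmax.1 hLH hdec
  have hdiv : IsWeaklyDivFree (u 0) := hLH.isWeaklyDivFree_datum hT
  obtain ⟨v, hmild, hcont, hv0, hmeas, -, -⟩ := H ν hν (u 0) hu0 hdiv hle
  have hglob : HasGlobalKatoSolution ν (u 0) := ⟨v, hmild, hcont, hv0, hmeas⟩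
  have htop : katoMaximalTime ν (u 0) = ⊤ := hglob.katoMaximalTime_eq_top
  -- while the lifespan of the witness is its (finite) Kato maximal time
  rw [katoMaximalTime_eq_of_isMaximalSmoothSolution hν hT hmax hLH hdec] at htop
  exact ENNReal.ofReal_ne_top htop

end Summit.NavierStokesRegularity.NavierStokesRegularity.Theorems.CertifiedBlowupAxisymBlowup.CompactAmplification

end
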